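import Summits.CriticalPhenomena.PercolationContinuityZ3.Theorems.PercNearOneGluingNoHeavyLowerTailSunflowerMultiPetalKempeMarkedStepOne
import Summits.CriticalPhenomena.PercolationContinuityZ3.Theorems.PercNearOneGluingNoHeavyLowerTailSunflowerMultiPetalKempeMarkedActive
import Summits.CriticalPhenomena.PercolationContinuityZ3.Theorems.PercNearOneGluingNoHeavyLowerTailSunflowerMultiPetalKempeMarkedSymmetry
import Summits.CriticalPhenomena.PercolationContinuityZ3.Theorems.PercNearOneGluingNoHeavyLowerTailSunflowerMultiPetalKempeBridge
import HarnessLib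
import HarnessLib.Audit

/-!
# `NoHeavyLowerTail` (crux stmt-CriticalPhenomena-4575): **LEMMA B FOR EVERY MARKED MULTIGRAPH (`Q ≥ 0`) AND THE TWO-TERMINAL INEQUALITY (C*) (`T ≥ 0`),
# KERNEL-CHECKED**, with the simple-graph corollaries `Qcol G ≥ 0`, `Tfun G u v ≥ 0`

Support file (seat `prim-l12-p2` gen 49; `--supports stmt-CriticalPhenomena-4575`; assembles `…KempeMarkedStepOne` (p607581), `…KempeMarkedStep` (p597137),
`…KempeMarkedClasses` (p608443, THEOREM R), `…KempeMarkedActive` (measure, terminal-isolated identity), `…KempeMarkedExpansion`/`…Swap`/`…QSide` (marked-vertex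
monotonicity, THEOREM MT), `…KempeMarkedSymmetry`).  No `sorry`; nothing is asserted about the crux.
Memo: run/shared/lean/prim/prim-l12/prim-l12-p2/PROOF-LEMMA-B-MARKED-MULTIGRAPHS-g47.md §3.

THE INDUCTION on the number of active vertices, jointly for `Q ≥ 0` and `T ≥ 0`:
* `Q(K)`: pick an active `x`; marked ⇒ `Q(K−x) ≤ Q(K)` (p597318); unmarked ⇒ THEOREM R (`QcolM_isolate_le_of_classes`) with the induction hypothesis on the
  contractions; no active vertex ⇒ `Q = 0`;
* `T(K;u,v)`: a marked non-terminal ⇒ `T(K−y) ≤ T(K)` (p595201); an unmarked non-terminal adjacent to `u` (or to `v`, by `TfunM_comm`) ⇒ the step law for its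
  outer degree (`TfunM_step_zero` / `TfunM_step_one` / `TfunM_step`); otherwise a marked terminal ⇒ THEOREM MT (p595260), else `9·T = Q(L⁺ᵘ) + Q(L⁺ᵛ)`
  (`nine_mul_TfunM_eq`) and `Q(L⁺ʷ) ≥ Q(L)/3 ≥ 0`.
RESULTS: **`QcolM_nonneg`** (LEMMA B for every marked multigraph), **`TfunM_nonneg`** ((C*)), `QcolM_isolate_le` (`Q(K−x) ≤ Q(K)` for EVERY vertex), and for
SIMPLE GRAPHS **`Qcol_nonneg_all`** (Lemma B in colouring language for every finite graph — the hypothesis-free form of p414773's `Qcol_nonneg_of_pinnedMZ`)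
and `Tfun_nonneg_all`.
-/

namespace Summit.CriticalPhenomena.PercolationContinuityZ3.Theorems.SunflowerPartition.Kempe

open Finset

namespace MGraph

variable {V : Type*} [Fintype V] [LinearOrder V] (K : MGraph V)

/-! ## The joint induction: LEMMA B and (C*) for every marked multigraph -/

section Induction

/-- With no active vertex every type is `(0,0,0)` and `Q = 0`. [this work] -/
theorem QcolM_eq_zero_of_active_eq_empty (h : K.active = ∅) : K.QcolM = 0 := by
  have hfree : ∀ w, K.IsFree w := fun w => K.isFree_of_not_mem_active (by rw [h]; exact notMem_empty w)
  have hm : ∀ x y, K.mul x y = 0 := fun x y => (hfree x).1 y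
  have hk : ∀ x, K.mark x = 0 := fun x => (hfree x).2
  have hcnt : ∀ σ c, K.cntM σ c = 0 := by
    intro σ c
    unfold cntM
    simp [hm, hk]
  unfold QcolM
  refine sum_eq_zero fun σ _ => ?_
  unfold ctypeM
  rw [hcnt, hcnt, hcnt]
  decide

/-- **Q-STEP of the induction**: if `Q ≥ 0` and `T ≥ 0` hold for all marked multigraphs with fewer active vertices, then `Q(K) ≥ 0`. [this work] -/
theorem QcolM_nonneg_step (n : ℕ)
    (ih : ∀ K' : MGraph V, K'.active.card < n → 0 ≤ K'.QcolM ∧ ∀ u v, u ≠ v → 0 ≤ K'.TfunM u v)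
    (hK : K.active.card ≤ n) : 0 ≤ K.QcolM := by
  by_cases hact : K.active = ∅
  · rw [K.QcolM_eq_zero_of_active_eq_empty hact]
  obtain ⟨x, hx⟩ := nonempty_of_ne_empty hact
  have hlt : (K.isolate x).active.card < n := lt_of_lt_of_le (K.card_active_isolate_lt hx) hK
  have h0 := (ih _ hlt).1
  by_cases hmark : K.mark x = 0
  · have hx' := (K.mem_active).1 hx
    rcases hx' with h | ⟨w₀, hw₀⟩
    · exact absurd hmark h
    have hw₀act : w₀ ∈ K.active := K.mem_active_of_mul_ne_zero' hw₀
    have hw₀x : w₀ ≠ x := K.ne_of_mem_nbrs x ((K.mem_nbrs x).2 hw₀)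
    have hC : (K.peelContract x ((K.nbrs x).erase w₀) w₀).active.card < n :=
      lt_of_lt_of_le (lt_of_le_of_lt (card_le_card (K.active_peelContract_subset x w₀ _ hw₀act)) (card_erase_lt_of_mem hx)) hK
    have hC' : ((K.peelContract x ((K.nbrs x).erase w₀) w₀).addMark w₀ (K.mdeg x)).active.card < n := by
      refine lt_of_lt_of_le (lt_of_le_of_lt (card_le_card ?_) (card_erase_lt_of_mem hx)) hK
      refine (active_addMark_subset _ w₀ _).trans (insert_subset (mem_erase.2 ⟨hw₀x, hw₀act⟩) ?_)
      exact K.active_peelContract_subset x w₀ _ hw₀act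
    have hR := K.QcolM_isolate_le_of_classes x hmark hw₀ (ih _ hC).1 (ih _ hC').1 (fun p α _ hαp hα => by
      have hαact : α ∈ K.active := K.mem_active_of_mul_ne_zero' hα
      have hlt' : (K.peelContract x (((K.nbrs x).erase p).erase α) α).active.card < n :=
        lt_of_lt_of_le (lt_of_le_of_lt (card_le_card (K.active_peelContract_subset x α _ hαact)) (card_erase_lt_of_mem hx)) hK
      exact (ih _ hlt').2 α p hαp)
    linarith
  · have hR := K.QcolM_isolate_le_of_mark x hmark
    linarith

/-- **T-STEP of the induction**: if `Q ≥ 0`, `T ≥ 0` hold below `n` active vertices and `Q ≥ 0` at `n`, then `T(K;u,v) ≥ 0` at `n`. [this work] -/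
theorem TfunM_nonneg_step (n : ℕ)
    (ih : ∀ K' : MGraph V, K'.active.card < n → 0 ≤ K'.QcolM ∧ ∀ u v, u ≠ v → 0 ≤ K'.TfunM u v)
    (hQ : ∀ K' : MGraph V, K'.active.card ≤ n → 0 ≤ K'.QcolM)
    (hK : K.active.card ≤ n) (u v : V) (huv : u ≠ v) : 0 ≤ K.TfunM u v := by
  -- (a) a marked non-terminal is deleted monotonically
  by_cases ha : ∃ y, y ≠ u ∧ y ≠ v ∧ K.mark y ≠ 0
  · obtain ⟨y, hyu, hyv, hmy⟩ := ha
    let u' : ({y}ᶜ : Set V) := ⟨u, Set.mem_compl_singleton_iff.mpr hyu.symm⟩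
    let v' : ({y}ᶜ : Set V) := ⟨v, Set.mem_compl_singleton_iff.mpr hyv.symm⟩
    have h1 := K.TfunM_isolate_le_of_mark y u' v' hmy
    dsimp only [u', v'] at h1
    have h0 := (ih _ (lt_of_lt_of_le (K.card_active_isolate_lt (K.mem_active_of_mark_ne_zero hmy)) hK)).2 u v huv
    linarith
  push Not at ha
  -- (b) an unmarked non-terminal joined to a terminal: the step law
  have key : ∀ u v y : V, u ≠ v → y ≠ u → y ≠ v → K.mark y = 0 → K.mul y u ≠ 0 → 0 ≤ K.TfunM u v := by
    intro u v y huv hyu hyv hmy hadj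
    set S := univ.filter (fun w : V => w ≠ u ∧ w ≠ v ∧ w ≠ y ∧ K.mul y w ≠ 0) with hSdef
    have hS : ∀ w, w ∈ S ↔ (w ≠ u ∧ w ≠ v ∧ w ≠ y ∧ K.mul y w ≠ 0) := fun w => by rw [hSdef, mem_filter]; simp
    have hyact : y ∈ K.active := K.mem_active_of_mul_ne_zero hadj
    have huact : u ∈ K.active := K.mem_active_of_mul_ne_zero' hadj
    have h0 : 0 ≤ (K.isolate y).TfunM u v := (ih _ (lt_of_lt_of_le (K.card_active_isolate_lt hyact) hK)).2 u v huv
    have hC : 0 ≤ (K.peelContract y S u).TfunM u v :=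
      (ih _ (lt_of_lt_of_le (lt_of_le_of_lt (card_le_card (K.active_peelContract_subset y u S huact)) (card_erase_lt_of_mem hyact)) hK)).2
        u v huv
    rcases Nat.lt_or_ge S.card 2 with hlt | hge
    · rcases Nat.lt_or_ge S.card 1 with h0' | h1'
      · -- outer degree 0
        have hS0 : S = ∅ := card_eq_zero.1 (by omega)
        have hnone : ∀ w, w ≠ u → w ≠ v → K.mul y w = 0 := by
          intro w hwu hwv
          by_cases hwy : w = y
          · rw [hwy]; exact K.loopless y
          by_contra hne
          have : w ∈ S := (hS w).2 ⟨hwu, hwv, hwy, hne⟩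
          rw [hS0] at this
          exact notMem_empty w this
        have hstep := K.TfunM_step_zero u v y huv hyu hyv hmy hadj hnone
        linarith
      · -- outer degree 1
        have hone : S.card = 1 := by omega
        have hstep := K.TfunM_step_one u v y huv hyu hyv hmy hadj S hS hone
        rw [hone] at hstep
        norm_num at hstep
        linarith
    · -- outer degree ≥ 2
      have hstep := K.TfunM_step u v y huv hyu hyv hmy hadj S hS hge
      have h3 : (0 : ℤ) < 3 ^ S.card := by positivity
      have h3' : (0 : ℤ) < 3 ^ (S.card + 1) := by positivity
      have hle : 0 ≤ 3 ^ (S.card + 1) * K.TfunM u v := le_trans (add_nonneg (mul_nonneg h3.le h0) hC) hstep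
      exact (mul_nonneg_iff_of_pos_left h3').1 hle
  by_cases hb : ∃ y, y ≠ u ∧ y ≠ v ∧ (K.mul y u ≠ 0 ∨ K.mul y v ≠ 0)
  · obtain ⟨y, hyu, hyv, hadj⟩ := hb
    rcases hadj with h | h
    · exact key u v y huv hyu hyv (ha y hyu hyv) h
    · rw [TfunM_comm]; exact key v u y huv.symm hyv hyu (ha y hyu hyv) h
  push Not at hb
  -- (c) the terminals are isolated from the rest
  by_cases hmu : K.mark u = 0
  swap
  · exact K.TfunM_nonneg_of_mark u v huv hmu
  by_cases hmv : K.mark v = 0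
  swap
  · rw [TfunM_comm]; exact K.TfunM_nonneg_of_mark v u huv.symm hmv
  have hid := K.nine_mul_TfunM_eq u v huv hmu hmv (fun w hwu hwv => hb w hwu hwv)
  set L := (K.isolate u).isolate v with hL
  have hLcard : L.active.card ≤ n :=
    le_trans (le_trans ((K.isolate u).card_active_isolate_le v) (K.card_active_isolate_le u)) hK
  have hQL := hQ L hLcard
  have hfu : L.IsFree u := isFree_isolate_of_isFree _ (K.isFree_isolate_self u) v
  have hfv : L.IsFree v := (K.isolate u).isFree_isolate_self v
  have hu1 := (L.addMark u 1).QcolM_isolate_le_of_mark u (by unfold addMark addAtU; simp)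
  have hv1 := (L.addMark v 1).QcolM_isolate_le_of_mark v (by unfold addMark addAtU; simp)
  have eu : (L.addMark u 1).isolate u = L := by unfold addMark; rw [isolate_addAtU, L.isolate_eq_of_isFree hfu]
  have ev : (L.addMark v 1).isolate v = L := by unfold addMark; rw [isolate_addAtU, L.isolate_eq_of_isFree hfv]
  rw [eu] at hu1
  rw [ev] at hv1
  linarith

/-- **THE JOINT INDUCTION**: for every `n`, every marked multigraph with at most `n` active vertices has `Q ≥ 0` and `T(·;u,v) ≥ 0`. [this work] -/
theorem lemmaB_and_twoTerminal (n : ℕ) :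
    ∀ K : MGraph V, K.active.card ≤ n → 0 ≤ K.QcolM ∧ ∀ u v, u ≠ v → 0 ≤ K.TfunM u v := by
  induction n using Nat.strong_induction_on with
  | _ n ihn =>
    intro K hK
    have ih : ∀ K' : MGraph V, K'.active.card < n → 0 ≤ K'.QcolM ∧ ∀ u v, u ≠ v → 0 ≤ K'.TfunM u v :=
      fun K' h => ihn K'.active.card h K' le_rfl
    have hQ : ∀ K' : MGraph V, K'.active.card ≤ n → 0 ≤ K'.QcolM := fun K' h => K'.QcolM_nonneg_step n ih h
    exact ⟨hQ K hK, fun u v huv => K.TfunM_nonneg_step n ih hQ hK u v huv⟩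

/-- **LEMMA B FOR EVERY MARKED MULTIGRAPH (kernel-checked)**: `Q(K) = Σ_σ lbW(type σ) ≥ 0`, i.e.
`2·N[≥2 monochromatic members, one class] ≥ N[two classes with exactly one] + N[one in each class]`. [this work] -/
theorem QcolM_nonneg : 0 ≤ K.QcolM := (lemmaB_and_twoTerminal _ K le_rfl).1

/-- **THE TWO-TERMINAL INEQUALITY (C*) FOR EVERY MARKED MULTIGRAPH (kernel-checked)**: `T(K;u,v) ≥ 0`. [this work] -/
theorem TfunM_nonneg (u v : V) : 0 ≤ K.TfunM u v := by
  by_cases huv : u = v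
  · subst huv
    unfold TfunM
    rw [sum_eq_zero]
    intro σ hσ
    have := (mem_filter.1 hσ).2
    rw [this.1] at this
    exact absurd this.2 (by decide)
  · exact (lemmaB_and_twoTerminal _ K le_rfl).2 u v huv

/-- **Vertex deletion is monotone for `Q` up to the freed vertex**: `Q(K.isolate x) ≤ 3·Q(K)` for EVERY vertex `x` (THEOREM R with all its hypotheses
now discharged; marked `x` by p597318; free `x` trivially). [this work] -/
theorem QcolM_isolate_le (x : V) : (K.isolate x).QcolM ≤ 3 * K.QcolM := by
  by_cases hmark : K.mark x = 0
  · by_cases hn : ∃ w, K.mul x w ≠ 0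
    · obtain ⟨w₀, hw₀⟩ := hn
      exact K.QcolM_isolate_le_of_classes x hmark hw₀ (QcolM_nonneg _) (QcolM_nonneg _) (fun p α _ _ _ => TfunM_nonneg _ α p)
    · push Not at hn
      rw [K.isolate_eq_of_isFree ⟨hn, hmark⟩]
      linarith [K.QcolM_nonneg]
  · exact K.QcolM_isolate_le_of_mark x hmark

end Induction

/-! ## Corollaries for simple graphs -/

section Simple

/-- **LEMMA B IN COLOURING LANGUAGE FOR EVERY FINITE SIMPLE GRAPH** (`Qcol G ≥ 0`; the hypothesis-free form of `Qcol_nonneg_of_pinnedMZ`, p414773). [this work] -/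
theorem Qcol_nonneg_all (G : SimpleGraph V) : 0 ≤ Qcol G := by
  classical
  have e : ∀ σ : V → Fin 3, lbW ((ofSimple G).ctypeM σ) = qcol G σ := fun σ => by rw [ctypeM_ofSimple, lbW_ctype]
  have h : (ofSimple G).QcolM = Qcol G := by
    unfold QcolM Qcol
    simp only [e]
    convert rfl
  rw [← h]
  exact QcolM_nonneg _

/-- **(C) FOR EVERY FINITE SIMPLE GRAPH**: `Tfun G u v ≥ 0`. [this work] -/
theorem Tfun_nonneg_all (G : SimpleGraph V) (u v : V) : 0 ≤ Tfun G u v := by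
  classical
  rw [← TfunM_ofSimple]
  exact TfunM_nonneg _ u v

end Simple

end MGraph

/-! ## Discharging the graph-case obligations of the programme -/

section Discharge

/-- **`TwoTerminalC` HOLDS** (the simple-graph two-terminal obligation of p416807, now a theorem; connectivity is not needed). [this work] -/
theorem twoTerminalC_holds : TwoTerminalC := by
  intro W _ G u v _ _
  classical
  letI : LinearOrder W := LinearOrder.lift' (Fintype.equivFin W) (Fintype.equivFin W).injective
  exact MGraph.Tfun_nonneg_all G u v

/-- **LEMMA B FOR EVERY FINITE SIMPLE GRAPH**, any vertex type: `0 ≤ Qcol H`. [this work] -/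
theorem Qcol_nonneg_univ {W : Type*} [Fintype W] (H : SimpleGraph W) : 0 ≤ Qcol H := by
  classical
  letI : LinearOrder W := LinearOrder.lift' (Fintype.equivFin W) (Fintype.equivFin W).injective
  exact MGraph.Qcol_nonneg_all H

open scoped Classical in
/-- **The graph case of `ClutterBottomSlackK`, unconditionally**: the bottom-spectator functional of the edge clutter of every finite graph is nonnegative
(hypothesis-free form of `QKW_edgeFam_nonneg_of_MZQConnected`, p413513). [this work] -/
theorem QKW_edgeFam_nonneg {W : Type*} [Fintype W] (H : SimpleGraph W) : 0 ≤ (MSunflower.ofClutter (edgeFam H)).QKW univ := by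
  rw [QKW_edgeFam_eq_Qcol]
  exact Qcol_nonneg_univ H

open scoped Classical in
/-- **★ₖ FOR THE EDGE CLUTTER OF EVERY FINITE GRAPH**: `0 ≤ ZK (ofClutter (edgeFam H))` (Lemma B ⟹ ★ₖ as in `ZK_ofClutter_nonneg_of_clutterBottomSlackK`). [this work] -/
theorem ZK_edgeFam_nonneg {W : Type*} [Fintype W] (H : SimpleGraph W) : 0 ≤ (MSunflower.ofClutter (edgeFam H)).ZK := by
  rw [← (MSunflower.ofClutter (edgeFam H)).ZKW_univ]
  exact le_trans (QKW_edgeFam_nonneg H) ((MSunflower.ofClutter (edgeFam H)).QKW_le_ZKW univ)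

end Discharge

end Summit.CriticalPhenomena.PercolationContinuityZ3.Theorems.SunflowerPartition.Kempe
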